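import Mathlib
import Summits.Ventures.HodgeRepro.Tier4.Common.KTypeSpace
import Summits.Ventures.HodgeRepro.Tier4.Line4.KTypeTransport

/-!
# Tier4/Line4/KTypeTransportGeneric — the scalar lemma of `KTypeTransport`, GENERIC in the space carrying the Riesz
vector (for the one-torus Riesz spaces of the F-L4-JOINT repair)

Blind re-derivation cell `pub-hodge-repro`, Tier 4 «prove the step» (README §9–§10), seat t4-L4-p1 (prover, LINE L4,
gen 3; O-L4-JOINT S13773).  Tree path `lean/Summits/Ventures/HodgeRepro/Tier4/Line4/KTypeTransportGeneric.lean`.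

WHAT IS PROVED.  `exists_scalar_conj_of_le_span_singleton_generic`: for ANY submodule `Wk ≤ V` into which `R(f)` maps
`V` (`hmap`) and which lies in a line (`hmult : ∃ v, Wk ≤ ℂ ∙ v`), `R(f̄)` acts on the conjugates of `Wk` by one scalar
— `KTypeTransport.exists_scalar_conj_of_le_span_singleton` with the joint `kTypeSpace` replaced by `Wk`; the
membership `hmap` is supplied clause by clause by `rightRegular_apply_mul_of_left_equivariant` for whichever clauses
the chosen Riesz space has (`T′`-weights + `K`, or `T`-weights + `K`), as `rightRegular_mem_kTypeSpace` does for the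
joint space.  Nothing of the wall's content is proved.

Nothing here says anything about the status of the Hodge conjecture for CM abelian varieties, which is NOT proved
(HC_CM is NOT proved by anyone in this repository).
-/

set_option autoImplicit false

noncomputable section

namespace Summit.Ventures.HodgeRepro.Tier4.Line4

open Summit.Ventures.HodgeRepro.Tier4.Common Summit.Ventures.HodgeRepro.Tier4.Line1 MeasureTheory NumberField
open scoped ComplexConjugate

section TransportGeneric

variable {k : Type} [Field k] [NumberField k] (W : PlaneData k) [MeasurableSpace (GA W)] [BorelSpace (GA W)]
  (μ : Measure (GA W)) [μ.IsHaarMeasure]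

omit [BorelSpace (GA W)] [μ.IsHaarMeasure] in
/-- `R(f̄)(conj ∘ ψ) = conj ∘ R(f) ψ` for the right-regular action. -/
theorem rightRegular_cj_conj (f ψ : GA W → ℂ) :
    rightRegular W μ (RTF.cj f) (fun x => conj (ψ x)) = fun x => conj (rightRegular W μ f ψ x) := by
  funext x
  simp only [rightRegular, RTF.cj]
  rw [← integral_conj]
  congr 1
  funext y
  simp only [map_mul]

omit [BorelSpace (GA W)] [μ.IsHaarMeasure] in
/-- **One scalar on a one-dimensional Riesz space, on the conjugates — generic**: if `R(f)` maps `V` into `Wk ≤ V`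
and `Wk` lies in a line, then `R(f̄)` acts on the conjugates of `Wk` by one scalar. -/
theorem exists_scalar_conj_of_le_span_singleton_generic (V Wk : Submodule ℂ (GA W → ℂ)) (hWk : Wk ≤ V)
    (f : GA W → ℂ) (hmap : ∀ ψ ∈ V, rightRegular W μ f ψ ∈ Wk)
    (hmult : ∃ v : GA W → ℂ, Wk ≤ Submodule.span ℂ {v}) :
    ∃ a : ℂ, ∀ ψ ∈ Wk, rightRegular W μ (RTF.cj f) (fun x => conj (ψ x)) = fun x => a * conj (ψ x) := by
  classical
  have hconj : ∀ ψ : GA W → ℂ, rightRegular W μ (RTF.cj f) (fun x => conj (ψ x)) =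
      fun x => conj (rightRegular W μ f ψ x) := fun ψ => rightRegular_cj_conj W μ f ψ
  have hscalar : ∃ a : ℂ, ∀ ψ ∈ Wk, rightRegular W μ f ψ = fun x => a * ψ x := by
    obtain ⟨v, hv⟩ := hmult
    by_cases hbot : ∃ w ∈ Wk, w ≠ 0
    · obtain ⟨w, hw, hwne⟩ := hbot
      obtain ⟨c, hc⟩ := Submodule.mem_span_singleton.1 (hv hw)
      have hcne : c ≠ 0 := by
        rintro rfl
        apply hwne
        rw [← hc, zero_smul]
      have hvWk : v ∈ Wk := by
        have : v = c⁻¹ • w := by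
          rw [← hc, smul_smul, inv_mul_cancel₀ hcne, one_smul]
        rw [this]
        exact Wk.smul_mem _ hw
      have hRv : rightRegular W μ f v ∈ Submodule.span ℂ {v} := hv (hmap v (hWk hvWk))
      obtain ⟨a, ha⟩ := Submodule.mem_span_singleton.1 hRv
      refine ⟨a, fun ψ hψ => ?_⟩
      obtain ⟨d, hd⟩ := Submodule.mem_span_singleton.1 (hv hψ)
      have e1 : ψ = fun x => d * v x := by
        rw [← hd]
        rfl
      rw [e1, rightRegular_const_mul, ← ha]
      funext x
      simp only [Pi.smul_apply, smul_eq_mul]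
      ring
    · have hbot' : ∀ ψ ∈ Wk, ψ = 0 := fun ψ hψ => by
        by_contra h
        exact hbot ⟨ψ, hψ, h⟩
      refine ⟨0, fun ψ hψ => ?_⟩
      rw [hbot' ψ hψ]
      have e : (0 : GA W → ℂ) = fun _ => 0 := rfl
      rw [e, rightRegular_zero]
      funext x
      simp
  obtain ⟨a, ha⟩ := hscalar
  refine ⟨conj a, fun ψ hψ => ?_⟩
  rw [hconj, ha ψ hψ]
  funext x
  simp only [map_mul]

end TransportGeneric

end Summit.Ventures.HodgeRepro.Tier4.Line4

end
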